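import Summits.SmoothPoincare4.SmoothPoincare4.Theorems.CongruenceShadowsAgkCor6SufficiencyStubSeamFlow
import Summits.SmoothPoincare4.SmoothPoincare4.Theorems.CongruenceShadowsAgkCor6SufficiencyStubSeamFormTube

/-!
# Stub `stub_transport` of line `lp-by-sphere-system-surgery` for crux `AgkCor6Sufficiency`, part 2:
# the drop onto a seam and the seam slabs (one trisection)
(item stmt-SmoothPoincare4-10894, routes CongruenceShadows / GroupTrisection; lead reshape r5, C;
registered helper stub `stub_transportSlabToolkit`)

For ONE trisection with its normalised presentation (`SpinePresentation`, `SeamForms`) and a seam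
flow `SeamFlow9` of the seam coordinate `σ_m = G (refIdx m) - 1`, this file studies the DROP
`seamDrop G m φ x = φ x (-σ_m x)` onto the seam (Milnor's drop onto a regular level along the
normalised gradient flow) and the SEAM SLAB
`seamSlab … ε₂ = {x ∈ Nf | |σ_m x| < ε₂, seamDrop x ∉ closedTube (3 r₀)}` — the open set on which the
transport of spine neighbourhoods is defined by flow conjugation.  Proved: the drop lands on the
seam inside `N m`, the flow brings it back (`φ (drop x) (σ x) = x`), the slab is open, contains the
seam piece off `T(4 r₀)`, its drops lie in `Nf` off `T(3 r₀)`; in the tube the drop is the explicit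
ray point with the same `ρ` and `p` (from `SeamFlow9.tube_form` and `σ = -2pq`); and the value of
the normalised presentation on `N m` is the band form on `T(10 r₀)` and the seam form `1 - σ`
unless `p < 6 r₀` (which forces the point into `T(9 r₀)`).

References: Abrams–Gay–Kirby, Geom. Topol. 22 (2018), proof of Thm. 5 [AbramsGayKirby2018];
Milnor, *Lectures on the h-cobordism theorem* (1965), proof of Thm. 3.4 [MilnorHCobordism1965].
-/

noncomputable section

set_option linter.dupNamespace false

namespace Summit.SmoothPoincare4.SmoothPoincare4.Cruxes.AgkCor6Sufficiency.LpBySphereSystemSurgery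

open Set Function
open scoped _root_.Manifold _root_.ContDiff _root_.Topology
open Literature.Topology.FourManifolds

/-! ## Definitions -/

section Defs

variable {X : Type}

/-- The seam coordinate `σ_m = G (refIdx m) - 1`. -/
def seamSig (G : Fin 3 → X → ℝ) (m : Fin 3) (x : X) : ℝ := G (refIdx m) x - 1

/-- The drop onto the seam along the flow `φ`: `φ x (-σ_m x)`. -/
def seamDrop (G : Fin 3 → X → ℝ) (m : Fin 3) (φ : X → ℝ → X) (x : X) : X :=
  φ x (-(seamSig G m x))

/-- The closed tube `{x ∈ Ot | u² + v² ≤ s²}`. -/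
def closedTube (Ot : Set X) (u v : X → ℝ) (s : ℝ) : Set X := {x | x ∈ Ot ∧ u x ^ 2 + v x ^ 2 ≤ s ^ 2}

/-- The seam slab of thickness `ε₂`: points of `Nf` with `|σ_m| < ε₂` whose drop lies off the
closed tube of radius `3 r₀`. -/
def seamSlab (Ot : Set X) (u v : X → ℝ) (G : Fin 3 → X → ℝ) (r₀ : ℝ) (m : Fin 3) (Nf : Set X)
    (φ : X → ℝ → X) (ε₂ : ℝ) : Set X :=
  {x | x ∈ Nf ∧ |seamSig G m x| < ε₂ ∧ seamDrop G m φ x ∉ closedTube Ot u v (3 * r₀)}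

/-- Unfolding of `seamSig`. -/
theorem seamSig_eq (G : Fin 3 → X → ℝ) (m : Fin 3) (x : X) : seamSig G m x = G (refIdx m) x - 1 := rfl

/-- Open tubes lie in the closed tubes of the same radius. -/
theorem tubeSet_subset_closedTube (Ot : Set X) (u v : X → ℝ) (s : ℝ) :
    tubeSet Ot u v s ⊆ closedTube Ot u v s := fun _ hx => ⟨hx.1, hx.2.le⟩

/-- A closed tube lies in every open tube of larger radius. -/
theorem closedTube_subset_tubeSet (Ot : Set X) (u v : X → ℝ) {s s' : ℝ} (hs : 0 ≤ s) (h : s < s') :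
    closedTube Ot u v s ⊆ tubeSet Ot u v s' := fun _ hx =>
  ⟨hx.1, lt_of_le_of_lt hx.2 (by nlinarith)⟩

end Defs

/-! ## One trisection: the drop and the slab -/

section OneSide

variable {X : Type} [TopologicalSpace X] [ChartedSpace (EuclideanSpace ℝ (Fin 4)) X]
  {S : Fin 3 → Set X} {u v : X → ℝ} {ρ : X → X} {U O T₀ Ot : Set X} {k : ℕ} {rt : ℝ}
  {tp : X → ℝ → ℝ → X} {G : Fin 3 → X → ℝ} {r₀ ε₁ : ℝ} {N : Fin 3 → Set X} {m : Fin 3}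
  {Nf : Set X} {δ : ℝ} {φ : X → ℝ → X}

/-- The drop of a point of `Nf` with `|σ| < δ` lies in `N m`. -/
theorem drop_mem_N (hfl : SeamFlow9 S u v ρ Ot tp G r₀ N m Nf δ φ) {x : X} (hx : x ∈ Nf)
    (hσ : |seamSig G m x| < δ) : seamDrop G m φ x ∈ N m :=
  hfl.mapsTo x hx _ (by rw [mem_Ioo, abs_lt] at *; constructor <;> linarith [hσ.1, hσ.2])

/-- The seam coordinate vanishes at the drop. -/
theorem seamSig_drop (hfl : SeamFlow9 S u v ρ Ot tp G r₀ N m Nf δ φ) {x : X} (hx : x ∈ Nf)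
    (hσ : |seamSig G m x| < δ) : seamSig G m (seamDrop G m φ x) = 0 := by
  have h := hfl.sigma_flow x hx (-(seamSig G m x))
    (by rw [mem_Ioo, abs_lt] at *; constructor <;> linarith [hσ.1, hσ.2])
  unfold seamDrop seamSig at *
  linarith

/-- **The drop lands on the seam.** -/
theorem drop_mem_seam (hSF : SeamForms S u v Ot G r₀ ε₁ N)
    (hfl : SeamFlow9 S u v ρ Ot tp G r₀ N m Nf δ φ) {x : X} (hx : x ∈ Nf)
    (hσ : |seamSig G m x| < δ) : seamDrop G m φ x ∈ S (m + 1) ∩ S (m + 2) :=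
  (hSF.zero_iff m _ (drop_mem_N hfl hx hσ)).1 (by
    have := seamSig_drop hfl hx hσ; unfold seamSig at this; linarith)

/-- On the seam (inside `N m`) the seam coordinate vanishes. -/
theorem seamSig_eq_zero_of_mem_seam (hSF : SeamForms S u v Ot G r₀ ε₁ N) {x : X} (hx : x ∈ N m)
    (hs : x ∈ S (m + 1) ∩ S (m + 2)) : seamSig G m x = 0 := by
  unfold seamSig; rw [(hSF.zero_iff m x hx).2 hs]; ring

/-- The drop of a seam point of `Nf` is the point itself. -/
theorem drop_of_mem_seam (hSF : SeamForms S u v Ot G r₀ ε₁ N)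
    (hfl : SeamFlow9 S u v ρ Ot tp G r₀ N m Nf δ φ) {x : X} (hx : x ∈ Nf)
    (hs : x ∈ S (m + 1) ∩ S (m + 2)) : seamDrop G m φ x = x := by
  unfold seamDrop
  rw [seamSig_eq_zero_of_mem_seam hSF (hfl.Nf_subset hx) hs, neg_zero, hfl.flow_zero x hx]

/-- A drop lying off the closed tube `closedTube (3 r₀)` lies off `T(2 r₀)` and in `Nf`. -/
theorem drop_mem_Nf_of_not_mem (hSF : SeamForms S u v Ot G r₀ ε₁ N)
    (hfl : SeamFlow9 S u v ρ Ot tp G r₀ N m Nf δ φ) {x : X} (hx : x ∈ Nf)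
    (hσ : |seamSig G m x| < δ) (hnot : seamDrop G m φ x ∉ closedTube Ot u v (3 * r₀)) :
    seamDrop G m φ x ∉ tubeSet Ot u v (2 * r₀) ∧ seamDrop G m φ x ∈ Nf := by
  have hr₀ := hSF.r₀_pos
  have h2 : seamDrop G m φ x ∉ tubeSet Ot u v (2 * r₀) := fun h =>
    hnot (tubeSet_subset_closedTube Ot u v _ (tubeSet_mono (by linarith) (by linarith) h))
  exact ⟨h2, hfl.seam_subset _ (drop_mem_seam hSF hfl hx hσ) h2⟩

/-- **The flow brings the drop back**: `φ (drop x) (σ x) = x`, when the drop is in `Nf`. -/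
theorem flow_drop (hfl : SeamFlow9 S u v ρ Ot tp G r₀ N m Nf δ φ) {x : X} (hx : x ∈ Nf)
    (hσ : |seamSig G m x| < δ) (hdrop : seamDrop G m φ x ∈ Nf) :
    φ (seamDrop G m φ x) (seamSig G m x) = x := by
  have hIoo : seamSig G m x ∈ Ioo (-δ) δ := by
    rw [mem_Ioo]; rw [abs_lt] at hσ; exact ⟨hσ.1, hσ.2⟩
  have hIoo' : -(seamSig G m x) ∈ Ioo (-δ) δ := by
    rw [mem_Ioo] at hIoo ⊢; constructor <;> linarith [hIoo.1, hIoo.2]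
  unfold seamDrop at hdrop ⊢
  rw [hfl.flow_add x hx _ _ hIoo' hIoo (by rw [neg_add_cancel, mem_Ioo]; exact
    ⟨by linarith [hfl.δ_pos], hfl.δ_pos⟩) hdrop, neg_add_cancel, hfl.flow_zero x hx]

/-- Smoothness of the seam coordinate. -/
theorem contMDiff_seamSig (hP : SpinePresentation S u v ρ U O T₀ G k) (m : Fin 3) :
    ContMDiff (𝓡 4) 𝓘(ℝ, ℝ) ∞ (seamSig G m) :=
  (hP.contMDiff_G _).sub contMDiff_const

/-- **Smoothness of the drop** on `{x ∈ Nf | |σ_m x| < δ}`. -/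
theorem contMDiffOn_drop [IsManifold (𝓡 4) ∞ X] (hP : SpinePresentation S u v ρ U O T₀ G k)
    (hfl : SeamFlow9 S u v ρ Ot tp G r₀ N m Nf δ φ) :
    ContMDiffOn (𝓡 4) (𝓡 4) ∞ (seamDrop G m φ) {x | x ∈ Nf ∧ |seamSig G m x| < δ} := by
  have hpair : ContMDiffOn (𝓡 4) ((𝓡 4).prod 𝓘(ℝ, ℝ)) ∞ (fun x => (x, -(seamSig G m x)))
      {x | x ∈ Nf ∧ |seamSig G m x| < δ} :=
    (contMDiffOn_id.prodMk (contMDiff_seamSig hP m).neg.contMDiffOn)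
  refine (hfl.contMDiffOn.comp hpair fun x hx => ⟨hx.1, ?_⟩).congr fun x _ => rfl
  obtain ⟨-, hxσ⟩ := hx
  rw [abs_lt] at hxσ
  show -δ < -seamSig G m x ∧ -seamSig G m x < δ
  constructor <;> linarith [hxσ.1, hxσ.2]

/-- The domain `{x ∈ Nf | |σ_m x| < δ}` of the drop is open. -/
theorem isOpen_dropDomain (hP : SpinePresentation S u v ρ U O T₀ G k)
    (hfl : SeamFlow9 S u v ρ Ot tp G r₀ N m Nf δ φ) : IsOpen {x | x ∈ Nf ∧ |seamSig G m x| < δ} :=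
  hfl.isOpen_Nf.inter (isOpen_lt (continuous_abs.comp (contMDiff_seamSig hP m).continuous)
    continuous_const)

/-- **The seam slab is open** (for `ε₂ ≤ δ`; the closed tube is closed, `3 r₀ < rt`). -/
theorem isOpen_seamSlab [T2Space X] [IsManifold (𝓡 4) ∞ X] (hP : SpinePresentation S u v ρ U O T₀ G k)
    (hTS : TubeStructure (S 0) (⋂ l, S l) u v ρ O Ot rt tp) (hSF : SeamForms S u v Ot G r₀ ε₁ N)
    (hfl : SeamFlow9 S u v ρ Ot tp G r₀ N m Nf δ φ) (hrt : 20 * r₀ ≤ rt) {ε₂ : ℝ} (hε : ε₂ ≤ δ) :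
    IsOpen (seamSlab Ot u v G r₀ m Nf φ ε₂) := by
  have hr₀ := hSF.r₀_pos
  have hcl : IsClosed (closedTube Ot u v (3 * r₀)) :=
    isClosed_closedTube hTS hP.tri.frame (by linarith) (by linarith)
  have hcont : ContinuousOn (seamDrop G m φ) {x | x ∈ Nf ∧ |seamSig G m x| < δ} :=
    (contMDiffOn_drop hP hfl).continuousOn
  obtain ⟨W, hWo, hW⟩ := (continuousOn_iff'.1 hcont) _ hcl.isOpen_compl
  have heq : seamSlab Ot u v G r₀ m Nf φ ε₂ =
      (W ∩ {x | x ∈ Nf ∧ |seamSig G m x| < δ}) ∩ {x | |seamSig G m x| < ε₂} := by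
    ext x
    constructor
    · rintro ⟨hx, hσ, hnot⟩
      have hxd : x ∈ {x | x ∈ Nf ∧ |seamSig G m x| < δ} := ⟨hx, lt_of_lt_of_le hσ hε⟩
      have : x ∈ seamDrop G m φ ⁻¹' (closedTube Ot u v (3 * r₀))ᶜ ∩
          {x | x ∈ Nf ∧ |seamSig G m x| < δ} := ⟨hnot, hxd⟩
      rw [hW] at this
      exact ⟨this, hσ⟩
    · rintro ⟨hxW, hσ⟩
      have : x ∈ seamDrop G m φ ⁻¹' (closedTube Ot u v (3 * r₀))ᶜ ∩
          {x | x ∈ Nf ∧ |seamSig G m x| < δ} := by rw [hW]; exact hxW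
      exact ⟨hxW.2.1, hσ, this.1⟩
  rw [heq]
  exact (hWo.inter (isOpen_dropDomain hP hfl)).inter
    (isOpen_lt (continuous_abs.comp (contMDiff_seamSig hP m).continuous) continuous_const)

/-- **The slab contains the seam piece off `T(4 r₀)`** (for any `ε₂ > 0`). -/
theorem mem_seamSlab_of_mem_seam (hSF : SeamForms S u v Ot G r₀ ε₁ N)
    (hfl : SeamFlow9 S u v ρ Ot tp G r₀ N m Nf δ φ) {ε₂ : ℝ} (hε : 0 < ε₂) {x : X}
    (hs : x ∈ S (m + 1) ∩ S (m + 2)) (h4 : x ∉ tubeSet Ot u v (4 * r₀)) :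
    x ∈ seamSlab Ot u v G r₀ m Nf φ ε₂ := by
  have hr₀ := hSF.r₀_pos
  have h2 : x ∉ tubeSet Ot u v (2 * r₀) := fun h => h4 (tubeSet_mono (by linarith) (by linarith) h)
  have hx : x ∈ Nf := hfl.seam_subset x hs h2
  refine ⟨hx, ?_, ?_⟩
  · rw [seamSig_eq_zero_of_mem_seam hSF (hfl.Nf_subset hx) hs, abs_zero]; exact hε
  · rw [drop_of_mem_seam hSF hfl hx hs]
    exact fun h => h4 (closedTube_subset_tubeSet Ot u v (by linarith) (by linarith) h)

/-- Points of the slab: the drop is a seam point in `Nf`, off `T(2 r₀)`, flowing back to `x`. -/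
theorem seamSlab_spec (hSF : SeamForms S u v Ot G r₀ ε₁ N)
    (hfl : SeamFlow9 S u v ρ Ot tp G r₀ N m Nf δ φ) {ε₂ : ℝ} (hε : ε₂ ≤ δ) {x : X}
    (hx : x ∈ seamSlab Ot u v G r₀ m Nf φ ε₂) :
    x ∈ Nf ∧ |seamSig G m x| < δ ∧ seamDrop G m φ x ∈ S (m + 1) ∩ S (m + 2) ∧
      seamDrop G m φ x ∈ Nf ∧ seamDrop G m φ x ∉ tubeSet Ot u v (2 * r₀) ∧
      seamDrop G m φ x ∉ closedTube Ot u v (3 * r₀) ∧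
      φ (seamDrop G m φ x) (seamSig G m x) = x := by
  obtain ⟨hxN, hσ, hnot⟩ := hx
  have hσδ : |seamSig G m x| < δ := lt_of_lt_of_le hσ hε
  obtain ⟨h2, hNf⟩ := drop_mem_Nf_of_not_mem hSF hfl hxN hσδ hnot
  exact ⟨hxN, hσδ, drop_mem_seam hSF hfl hxN hσδ, hNf, h2, hnot, flow_drop hfl hxN hσδ hNf⟩

/-! ### In the tube: the explicit drop -/

/-- **Box data of a point of `N m` in `T(10 r₀)`**: `p > r₀`, `|q| < r₀/2`, `σ = -2pq`. -/
theorem box_of_mem_N (hSF : SeamForms S u v Ot G r₀ ε₁ N) {x : X} (hx : x ∈ N m)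
    (h10 : x ∈ tubeSet Ot u v (10 * r₀)) :
    r₀ < pCo m (u x) (v x) ∧ |qCo m (u x) (v x)| < r₀ / 2 ∧
      seamSig G m x = -2 * pCo m (u x) (v x) * qCo m (u x) (v x) := by
  obtain ⟨hp, hq⟩ := (hSF.N_tube m x h10).1 hx
  exact ⟨hp, hq, hSF.sigma_tube m x h10 (by linarith [hSF.r₀_pos]) hq⟩

/-- **The explicit drop in the tube**: for `x ∈ Nf ∩ T(9 r₀)` with `|σ| < δ`, the drop is the ray
point `tp (ρ x) (uOfPQ m p 0) (vOfPQ m p 0)`, `p = p(x)`; it lies in `Ot` over `ρ x` with normal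
coordinates on the ray, `p (drop) = p`, `q (drop) = 0`. -/
theorem drop_eq_ray (hP : SpinePresentation S u v ρ U O T₀ G k)
    (hTS : TubeStructure (S 0) (⋂ l, S l) u v ρ O Ot rt tp) (hSF : SeamForms S u v Ot G r₀ ε₁ N)
    (hfl : SeamFlow9 S u v ρ Ot tp G r₀ N m Nf δ φ) (hrt : 20 * r₀ ≤ rt) {x : X} (hx : x ∈ Nf)
    (hσ : |seamSig G m x| < δ) (h9 : x ∈ tubeSet Ot u v (9 * r₀)) :
    seamDrop G m φ x = tp (ρ x) (uOfPQ m (pCo m (u x) (v x)) 0) (vOfPQ m (pCo m (u x) (v x)) 0) ∧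
    seamDrop G m φ x ∈ Ot ∧ ρ (seamDrop G m φ x) = ρ x ∧
    u (seamDrop G m φ x) = uOfPQ m (pCo m (u x) (v x)) 0 ∧
    v (seamDrop G m φ x) = vOfPQ m (pCo m (u x) (v x)) 0 ∧
    pCo m (u (seamDrop G m φ x)) (v (seamDrop G m φ x)) = pCo m (u x) (v x) ∧
    qCo m (u (seamDrop G m φ x)) (v (seamDrop G m φ x)) = 0 := by
  have hr₀ := hSF.r₀_pos
  have h10 : x ∈ tubeSet Ot u v (10 * r₀) := tubeSet_mono (by linarith) (by linarith) h9
  obtain ⟨hp, -, hσeq⟩ := box_of_mem_N hSF (hfl.Nf_subset hx) h10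
  set p := pCo m (u x) (v x) with hpdef
  set q := qCo m (u x) (v x) with hqdef
  have hp0 : p ≠ 0 := by linarith
  have hIoo : -(seamSig G m x) ∈ Ioo (-δ) δ := by
    rw [mem_Ioo]; rw [abs_lt] at hσ; constructor <;> linarith [hσ.1, hσ.2]
  have hform := hfl.tube_form x hx h9 _ hIoo
  have hq0 : q - -(seamSig G m x) / (2 * p) = 0 := by
    rw [hσeq]; field_simp; ring
  have hdrop : seamDrop G m φ x = tp (ρ x) (uOfPQ m p 0) (vOfPQ m p 0) := by
    unfold seamDrop; rw [hform, hq0]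
  -- the radius of the ray point
  have hρF : ρ x ∈ ⋂ l, S l := hP.tri.frame.ρ_mem x (hTS.subset_O h9.1)
  have hray : uOfPQ m p 0 ^ 2 + vOfPQ m p 0 ^ 2 < rt ^ 2 := by
    have h1 := sq_ray_le m p
    have h2 : p ^ 2 ≤ u x ^ 2 + v x ^ 2 := pCo_sq_le m (u x) (v x)
    nlinarith [h9.2, hrt, hr₀]
  refine ⟨hdrop, ?_, ?_, ?_, ?_, ?_, ?_⟩ <;> rw [hdrop]
  · exact hTS.tp_mem _ hρF _ _ hray
  · exact hTS.ρ_tp _ hρF _ _ hray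
  · exact hTS.u_tp _ hρF _ _ hray
  · exact hTS.v_tp _ hρF _ _ hray
  · rw [hTS.u_tp _ hρF _ _ hray, hTS.v_tp _ hρF _ _ hray, pCo_uOfPQ_vOfPQ]
  · rw [hTS.u_tp _ hρF _ _ hray, hTS.v_tp _ hρF _ _ hray, qCo_uOfPQ_vOfPQ]

/-! ### Values of the normalised presentation on `N m` -/

/-- In `T(10 r₀) ∩ N m` (with `|σ| < ε₁`) the normalised presentation is the band form. -/
theorem norm_eq_bandForm (hSF : SeamForms S u v Ot G r₀ ε₁ N) {x : X} (hx : x ∈ N m)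
    (hσ : |seamSig G m x| < ε₁) (h10 : x ∈ tubeSet Ot u v (10 * r₀)) :
    G (normIdx m) x = bandForm r₀ (pCo m (u x) (v x)) (seamSig G m x) :=
  hSF.band m x h10 ((hSF.N_tube m x h10).1 hx).1 hσ

/-- **Seam form unless `p < 6 r₀` in the tube**: on `N m` with `|σ| < ε₁`, if NOT
(`x ∈ T(10 r₀)` and `p x < 6 r₀`) then `G (normIdx m) x = 1 - σ x`. -/
theorem norm_eq_seamForm (hSF : SeamForms S u v Ot G r₀ ε₁ N) {x : X} (hx : x ∈ N m)
    (hσ : |seamSig G m x| < ε₁)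
    (hnot : ¬ (x ∈ tubeSet Ot u v (10 * r₀) ∧ pCo m (u x) (v x) < 6 * r₀)) :
    G (normIdx m) x = 1 - seamSig G m x := by
  have hr₀ := hSF.r₀_pos
  by_cases h10 : x ∈ tubeSet Ot u v (10 * r₀)
  · rw [norm_eq_bandForm hSF hx hσ h10]
    exact bandForm_of_le hr₀ (not_lt.1 fun h => hnot ⟨h10, h⟩)
  · have h9 : x ∉ tubeSet Ot u v (9 * r₀) := fun h => h10 (tubeSet_mono (by linarith) (by linarith) h)
    have := hSF.seam_form m x hx h9 hσ
    unfold seamSig; linarith [this]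

/-- A point of `N m ∩ T(10 r₀)` with `p < 6 r₀` lies in `T(9 r₀)` (`|q| < r₀/2`). -/
theorem mem_tube9_of_p_lt (hSF : SeamForms S u v Ot G r₀ ε₁ N) {x : X} (hx : x ∈ N m)
    (h10 : x ∈ tubeSet Ot u v (10 * r₀)) (hp : pCo m (u x) (v x) < 6 * r₀) :
    x ∈ tubeSet Ot u v (9 * r₀) := by
  have hr₀ := hSF.r₀_pos
  obtain ⟨hp1, hq⟩ := (hSF.N_tube m x h10).1 hx
  refine ⟨h10.1, ?_⟩
  have h := normSq_le m (u x) (v x) (by linarith)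
  have h1 : (pCo m (u x) (v x) + |qCo m (u x) (v x)|) ^ 2 < (6 * r₀ + r₀ / 2) ^ 2 := by
    have h0 : 0 ≤ pCo m (u x) (v x) + |qCo m (u x) (v x)| := by linarith [abs_nonneg (qCo m (u x) (v x))]
    nlinarith
  nlinarith

end OneSide

/-! ## The registered helper stub -/

/-- **Toolkit of part 2** (registered helper stub `stub_transportSlabToolkit`, proved here):
the elementary inclusions between open and closed tubes. -/
def TransportSlabToolkit : Prop :=
  ∀ (X : Type) (Ot : Set X) (u v : X → ℝ) (s s' : ℝ), 0 ≤ s → s < s' →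
    tubeSet Ot u v s ⊆ closedTube Ot u v s ∧ closedTube Ot u v s ⊆ tubeSet Ot u v s'

/-- **Registered helper stub `stub_transportSlabToolkit`.** -/
theorem stub_transportSlabToolkit : TransportSlabToolkit := fun _ Ot u v _ _ hs h =>
  ⟨tubeSet_subset_closedTube Ot u v _, closedTube_subset_tubeSet Ot u v hs h⟩

end Summit.SmoothPoincare4.SmoothPoincare4.Cruxes.AgkCor6Sufficiency.LpBySphereSystemSurgery

end
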